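import Summits.Ventures.HSemireg.WedgePointPairPowersPerQOverlap

/-!
# Venture HSemireg — the three wedge models of FORMULA-N are ONE object: the `n`-fold point-pair box `pairBox` IS th-7's
# honest two-factor box (`n = 2` factors) and IS the surface box (`m = 2`), literally, not only numerically

HONEST FRAMING. Part of the Lean index of the computation cell `pub-hsemireg` (seat p10 gen 8, Sunday typer «UNIFORM-IN-n»).
Finite-dimensional EXTERIOR ALGEBRA over a field ONLY: no variety, no cohomology theory, no sheaf, no semiregularity map is constructed
here; nothing here says that HC / HC_CM / HC_AV holds; no Literature fact is declared or used.  THEOREMS ONLY (no definition).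

WHY THIS FILE.  The lineage's uniform theorems (`WedgePointPairPowers*.lean`: rank `[t^k]P_mⁿ`, per-`q` ranks `[t^k u^q]G_{m,n}`,
kernels) live on the ITERATED model `pairBox K (m) (n) a c ∈ ⋀ K^{(m+m)·n}`; th-7's original FORMULA-N theorems (THEOREM K∘T,
`WedgeBox*.lean`) live on `Fin (m+m+m+m)` with the honest box `fac1 a * fac2 a'`; the surface-power theorems (`WedgeSurfacePowers*.lean`,
STRUCTURE C10) live on `Fin (4n)`.  So far the three were tied together only NUMERICALLY (edge theorems `…_two_eq_boxRank`,
`coeff_pairPoly_two`, INDEX-p10 §E «NOT in the tree: the literal model isomorphisms»).  Here they are identified AS OBJECTS: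
* `emb_pairBox_two`: along the order isomorphism `Fin ((m+m)·2) ≃o Fin (m+m+m+m)` (`Fin.castOrderIso`, a re-typing of the same integers) the
  tree's block embedding `Wedge.Kunneth.emb` carries `pairBox K (m) (2) a c` to th-7's honest box `fac1 ![a,c] * fac2 ![a,c]`
  (equal coefficient pairs on the two factors) — the blocks `X₀, Y₀, X₁, Y₁` of the iterated model ARE th-7's `X, Y, X′, Y′`;
* `pairBox_two_eq_surfaceBox`: `pairBox K (2) (n) a c = SurfacePowers.surfaceBox K a c` on the nose (the types `Fin ((2+2)·n)` and
  `Fin (4·n)` are the same type; the block embeddings agree: `blockEmb_two_eq`);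
* `emb_pp_eq_pairBox_one`: one factor (`n = 1`) is th-7's point pair `WedgePair.pointPair` re-typed along `Fin (m+m) ≃o Fin ((m+m)·1)`;
* transport (`finrank_range_wedge_emb`, `finrank_ker_wedge_emb`: wedge ranks and kernel dimensions are invariant under `emb` along a
  SURJECTIVE order embedding, from the tree's `finrank_V_emb`), hence the uniform rank theorem SPECIALISES LITERALLY:
  `finrank_range_wedgeMap_fac_mul_eq_coeff` (th-7's model, every degree `k`, no `k ≤ 2m` guard: `= [t^k](pairPoly m)²`),
  `finrank_range_wedgeMap_pointPair_eq_coeff` (one pair, every `k`: `= [t^k] pairPoly m`); with p10 gen 4's `pairPoly_two_eq_surfPoly`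
  (`pairPoly 2 = 1 + 4t + t²`, `WedgePointPairPowersPerQOverlap.lean`) `finrank_range_surfaceBox` and `finrank_range_pairBox (m := 2)`
  are the same sentence;
* per `q` (§5, §6): the Dolbeault block projections of `WedgeSurfacePowersPerQSupport` ARE those of `WedgePointPairPowersPerQSupport`
  at `m = 2` (`blockProj_two_eq`, so the two per-`q` rank theorems measure one space, `range_blockProj_wedge_surfaceBox_eq`, and
  `spCount n k q = genCount 2 n k q` drops out, `spCount_eq_genCount_two`), and th-7's `WedgeBoxPerQ.blockProj` is the transported
  one (`emb_comp_blockProj_two`), so th-7's two-factor per-`q` ranks are `genCount m 2 k q` in EVERY degree including `0`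
  (`finrank_range_blockProj_wedgeMap_fac_mul_eq_genCount`).
DICTIONARY (quoted, NOT asserted; th-7 PART B §A.3): as in the three model files.  Namespace `Summit.Ventures.HSemireg.Wedge.PairPowers`.
-/

open Module Set Set.powersetCard Polynomial

namespace Summit.Ventures.HSemireg.Wedge.PairPowers

open Summit.Ventures.HSemireg.Wedge Summit.Ventures.HSemireg.Wedge.Kunneth

variable (K : Type*) [Field K]

/-! ## §1. Transport of wedge ranks and kernels along a surjective order embedding -/

/-- `dim ⋀^k K^ι = C(|ι|, k)`. -/
lemma finrank_exteriorPower_fun (ι : Type*) [Fintype ι] (k : ℕ) : finrank K (⋀[K]^k (ι → K)) = (Fintype.card ι).choose k := by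
  rw [exteriorPower.finrank_eq, finrank_fintype_fun_eq_card]

section Transport

variable {I J : Type*} [LinearOrder I] [Fintype I] [LinearOrder J] [Fintype J] (φ : J ↪o I)

/-- along an order embedding that hits every generator, `emb φ` preserves the rank of `θ ↦ θ ∧ f` on `⋀^k` (tree: `finrank_V_emb`). -/
theorem finrank_range_wedge_emb (hφ : Finset.univ.map φ.toEmbedding = Finset.univ) (f : HT K J) (k : ℕ) :
    finrank K (LinearMap.range (wedge K I k (emb K φ f))) = finrank K (LinearMap.range (wedge K J k f)) := by
  rw [← V_univ, ← hφ, finrank_V_emb]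

/-- … hence `emb φ` also preserves the KERNEL dimension of `θ ↦ θ ∧ f` on `⋀^k`. -/
theorem finrank_ker_wedge_emb (hφ : Finset.univ.map φ.toEmbedding = Finset.univ) (f : HT K J) (k : ℕ) :
    finrank K (LinearMap.ker (wedge K I k (emb K φ f))) = finrank K (LinearMap.ker (wedge K J k f)) := by
  have hc : Fintype.card J = Fintype.card I := by
    rw [← Finset.card_univ, ← Finset.card_univ (α := I), ← hφ, Finset.card_map]
  have h1 := LinearMap.finrank_range_add_finrank_ker (wedge K I k (emb K φ f))
  have h2 := LinearMap.finrank_range_add_finrank_ker (wedge K J k f)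
  rw [finrank_exteriorPower_fun K I, finrank_range_wedge_emb K φ hφ] at h1
  rw [finrank_exteriorPower_fun K J, hc] at h2
  omega

end Transport

/-! The re-typings below are the order isomorphisms `Fin.castOrderIso h : Fin a ≃o Fin b` for `h : a = b` (the identity on
values), used as order embeddings `(Fin.castOrderIso h).toOrderEmbedding` so that the tree's `Wedge.Kunneth.emb` applies. -/

/-- the re-typing is the identity on values. -/
lemma castEmb_val {a b : ℕ} (h : a = b) (i : Fin a) : (((Fin.castOrderIso h).toOrderEmbedding i : Fin b) : ℕ) = i := rfl

/-- the re-typing hits every generator. -/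
lemma map_univ_castEmb {a b : ℕ} (h : a = b) : Finset.univ.map (Fin.castOrderIso h).toOrderEmbedding.toEmbedding = Finset.univ :=
  Finset.map_univ_of_surjective fun j => ⟨⟨j, by omega⟩, Fin.ext rfl⟩

/-- membership in a doubly transported block, by value. -/
lemma mem_map_map_iff {m n b : ℕ} (h : (m + m) * n = b) (i : Fin n) (s : Finset (Fin (m + m))) (x : Fin b) :
    x ∈ (s.map (blockEmb m n i).toEmbedding).map (Fin.castOrderIso h).toOrderEmbedding.toEmbedding ↔
      ∃ j ∈ s, (x : ℕ) = (m + m) * i + j := by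
  simp only [Finset.mem_map, RelEmbedding.coe_toEmbedding]
  constructor
  · rintro ⟨y, ⟨j, hj, rfl⟩, rfl⟩
    exact ⟨j, hj, rfl⟩
  · rintro ⟨j, hj, hx⟩
    exact ⟨blockEmb m n i j, ⟨j, hj, rfl⟩, Fin.ext (by rw [castEmb_val, blockEmb_val]; exact hx.symm)⟩

variable {m n : ℕ}

/-- the transported point-pair factor, expanded on the two transported half-blocks. -/
lemma emb_castEmb_pfac {b : ℕ} (h : (m + m) * n = b) (a c : K) (i : Fin n) :
    emb K (Fin.castOrderIso h).toOrderEmbedding (pfac K (m := m) a c i) =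
      a • B K (Fin b) (((WedgePair.Xset m).map (blockEmb m n i).toEmbedding).map (Fin.castOrderIso h).toOrderEmbedding.toEmbedding) +
        c • B K (Fin b) (((WedgePair.Yset m).map (blockEmb m n i).toEmbedding).map (Fin.castOrderIso h).toOrderEmbedding.toEmbedding) := by
  rw [pfac, pp, WedgePair.pointPair, map_add, map_smul, map_smul, map_add, map_smul, map_smul, WedgePair.coe_Xpc,
    WedgePair.coe_Ypc, B_pair_eq, B_pair_eq, emb_B, emb_B, emb_B, emb_B]

/-! ## §2. Two factors: the iterated model IS th-7's honest box -/

/-- `(m+m)·2 = m+m+m+m` (the two index types hold the same integers). -/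
lemma two_blocks (m : ℕ) : (m + m) * 2 = m + m + m + m := by ring

/-- block `X₀` of the iterated model is th-7's `X = A 0`. -/
lemma X_zero_eq_A (m : ℕ) :
    ((WedgePair.Xset m).map (blockEmb m 2 0).toEmbedding).map ((Fin.castOrderIso (two_blocks m)).toOrderEmbedding).toEmbedding = WedgeBox.A m 0 := by
  ext x
  rw [mem_map_map_iff, WedgeBox.mem_A]
  constructor
  · rintro ⟨j, hj, hx⟩
    rw [WedgePair.mem_Xset] at hj
    simp only [Fin.val_zero] at hx ⊢
    omega
  · rintro ⟨h1, h2⟩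
    simp only [Fin.val_zero] at h1 h2
    exact ⟨⟨x, by omega⟩, by rw [WedgePair.mem_Xset]; simp only; omega, by simp⟩

/-- block `Y₀` of the iterated model is th-7's `Y = A 1`. -/
lemma Y_zero_eq_A (m : ℕ) :
    ((WedgePair.Yset m).map (blockEmb m 2 0).toEmbedding).map ((Fin.castOrderIso (two_blocks m)).toOrderEmbedding).toEmbedding = WedgeBox.A m 1 := by
  ext x
  rw [mem_map_map_iff, WedgeBox.mem_A]
  constructor
  · rintro ⟨j, hj, hx⟩
    rw [WedgePair.mem_Yset] at hj
    have := j.2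
    simp only [Fin.val_zero, Fin.val_one] at hx ⊢
    omega
  · rintro ⟨h1, h2⟩
    simp only [Fin.val_one] at h1 h2
    exact ⟨⟨x - 0, by omega⟩, by rw [WedgePair.mem_Yset]; simp only; omega, by simp⟩

/-- block `X₁` of the iterated model is th-7's `X′ = C 0`. -/
lemma X_one_eq_C (m : ℕ) :
    ((WedgePair.Xset m).map (blockEmb m 2 1).toEmbedding).map ((Fin.castOrderIso (two_blocks m)).toOrderEmbedding).toEmbedding = WedgeBox.C m 0 := by
  ext x
  rw [mem_map_map_iff, WedgeBox.mem_C]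
  constructor
  · rintro ⟨j, hj, hx⟩
    rw [WedgePair.mem_Xset] at hj
    simp only [Fin.val_one, Fin.val_zero] at hx ⊢
    omega
  · rintro ⟨h1, h2⟩
    simp only [Fin.val_zero] at h1 h2
    exact ⟨⟨x - (m + m), by omega⟩, by rw [WedgePair.mem_Xset]; simp only; omega, by simp only [Fin.val_one]; omega⟩

/-- block `Y₁` of the iterated model is th-7's `Y′ = C 1`. -/
lemma Y_one_eq_C (m : ℕ) :
    ((WedgePair.Yset m).map (blockEmb m 2 1).toEmbedding).map ((Fin.castOrderIso (two_blocks m)).toOrderEmbedding).toEmbedding = WedgeBox.C m 1 := by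
  ext x
  rw [mem_map_map_iff, WedgeBox.mem_C]
  constructor
  · rintro ⟨j, hj, hx⟩
    rw [WedgePair.mem_Yset] at hj
    have := j.2
    simp only [Fin.val_one] at hx ⊢
    omega
  · rintro ⟨h1, h2⟩
    simp only [Fin.val_one] at h1 h2
    exact ⟨⟨x - (m + m), by omega⟩, by rw [WedgePair.mem_Yset]; simp only; omega, by simp only [Fin.val_one]; omega⟩

/-- th-7's monomial basis on `Fin (m+m+m+m)` is the generic one. -/
lemma B_box_eq (s : Finset (WedgeBox.I m)) : WedgeBox.B K m s = B K (Fin (m + m + m + m)) s := rfl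

/-- **TWO FACTORS = th-7's HONEST BOX**: re-typed along `Fin ((m+m)·2) ≃o Fin (m+m+m+m)`, the iterated box `pairBox K (m) (2) a c`
IS `WedgeBox.fac1 ![a,c] * WedgeBox.fac2 ![a,c]` (equal coefficient pairs on the two factors). -/
theorem emb_pairBox_two (a c : K) :
    emb K ((Fin.castOrderIso (two_blocks m)).toOrderEmbedding) (pairBox K (m := m) (n := 2) a c) =
      WedgeBox.fac1 K m ![a, c] * WedgeBox.fac2 K m ![a, c] := by
  have e : pairBox K (m := m) (n := 2) a c = pfac K a c 0 * pfac K a c 1 := by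
    show (1 * dite _ _ _) * dite _ _ _ = _
    rw [dif_pos (show 0 < 2 by norm_num), dif_pos (show 1 < 2 by norm_num), one_mul]
    rfl
  rw [e, map_mul, emb_castEmb_pfac, emb_castEmb_pfac, X_zero_eq_A, Y_zero_eq_A, X_one_eq_C, Y_one_eq_C, WedgeBox.fac1,
    WedgeBox.fac2, Fin.sum_univ_two, Fin.sum_univ_two]
  simp only [Matrix.cons_val_zero, Matrix.cons_val_one, WedgeBox.coe_Apc, WedgeBox.coe_Cpc, B_box_eq]

/-- th-7's `wedgeMap` is the generic `wedge`. -/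
lemma wedgeMap_box_eq (k : ℕ) (v : WedgeBox.HT K m) : WedgeBox.wedgeMap K m k v = wedge K (WedgeBox.I m) k v := rfl

/-- **th-7's THEOREM K∘T, every degree, read off the uniform theorem**: on th-7's own model the rank of
`θ ↦ θ ∧ (fac1 ![a,c] ∧ fac2 ![a,c])` on `⋀^k K^{4m}` is `[t^k](pairPoly m)²` for EVERY `k` (`m ≥ 1`, `a, c ≠ 0`;
no `k ≤ 2m` guard — above `2m` both sides vanish).  Tree cross-references: `WedgeBox.finrank_range_wedgeMap_fac_mul_all` (th-7's own count, `k ≤ 2m`,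
general coefficient pairs), `finrank_range_pairBox_two_eq_boxRank` (the numerical edge). -/
theorem finrank_range_wedgeMap_fac_mul_eq_coeff (hm : 1 ≤ m) {a c : K} (ha : a ≠ 0) (hc : c ≠ 0) (k : ℕ) :
    finrank K (LinearMap.range (WedgeBox.wedgeMap K m k (WedgeBox.fac1 K m ![a, c] * WedgeBox.fac2 K m ![a, c]))) =
      (pairPoly m ^ 2).coeff k := by
  rw [wedgeMap_box_eq, ← emb_pairBox_two, finrank_range_wedge_emb K _ (map_univ_castEmb _),
    finrank_range_pairBox K hm (by norm_num) ha hc]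

/-- … and `= boxRank m k = [t^k]P_m²` (th-6's closed form, `FormulaN.Uniform.boxRank`), every `k`. -/
theorem finrank_range_wedgeMap_fac_mul_eq_boxRank (hm : 1 ≤ m) {a c : K} (ha : a ≠ 0) (hc : c ≠ 0) (k : ℕ) :
    finrank K (LinearMap.range (WedgeBox.wedgeMap K m k (WedgeBox.fac1 K m ![a, c] * WedgeBox.fac2 K m ![a, c]))) =
      FormulaN.Uniform.boxRank m k := by
  rw [wedgeMap_box_eq, ← emb_pairBox_two, finrank_range_wedge_emb K _ (map_univ_castEmb _)]
  exact finrank_range_pairBox_two_eq_boxRank K hm ha hc k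

/-- the KERNEL dimension on th-7's model equals the iterated model's, every degree. -/
theorem finrank_ker_wedgeMap_fac_mul_eq (a c : K) (k : ℕ) :
    finrank K (LinearMap.ker (WedgeBox.wedgeMap K m k (WedgeBox.fac1 K m ![a, c] * WedgeBox.fac2 K m ![a, c]))) =
      finrank K (LinearMap.ker (wedge K (Fin ((m + m) * 2)) k (pairBox K (m := m) (n := 2) a c))) := by
  rw [wedgeMap_box_eq, ← emb_pairBox_two, finrank_ker_wedge_emb K _ (map_univ_castEmb _)]

/-! ## §3. Surfaces: the iterated model at `m = 2` IS the surface box -/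

/-- the block embeddings of the two files agree (`(2+2)·i + j = 4·i + j`). -/
lemma blockEmb_two_eq (i : Fin n) : blockEmb 2 n i = SurfacePowers.blockEmb n i := by
  apply DFunLike.ext
  intro j
  exact Fin.ext (by rw [blockEmb_val]; rfl)

/-- the point-pair factor at `m = 2` is the surface factor. -/
lemma pfac_two_eq_fac (a c : K) (i : Fin n) : pfac K (m := 2) a c i = SurfacePowers.fac K a c i := by
  rw [pfac, SurfacePowers.fac, blockEmb_two_eq]
  rfl

/-- the partial products agree. -/
lemma prodFac_two_eq (a c : K) (j : ℕ) : prodFac K (m := 2) (n := n) a c j = SurfacePowers.prodFac K (n := n) a c j := by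
  induction j with
  | zero => rfl
  | succ j ih =>
    show prodFac K (m := 2) (n := n) a c j * _ = SurfacePowers.prodFac K (n := n) a c j * _
    rw [ih]
    by_cases h : j < n
    · rw [dif_pos h, dif_pos h, pfac_two_eq_fac]
    · rw [dif_neg h, dif_neg h]

/-- **SURFACES = `m = 2`**: the iterated box of surface point pairs IS p10 gen 2's surface box, on the nose. -/
theorem pairBox_two_eq_surfaceBox (a c : K) : pairBox K (m := 2) (n := n) a c = SurfacePowers.surfaceBox K a c :=
  prodFac_two_eq K a c n

/-- so `finrank_range_surfaceBox` (`[t^k](1+4t+t²)ⁿ`) and `finrank_range_pairBox (m := 2)` (`[t^k](pairPoly 2)ⁿ`; `pairPoly 2 = surfPoly`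
is p10 gen 4's `pairPoly_two_eq_surfPoly`, `WedgePointPairPowersPerQOverlap.lean`, there «the two models are not literally identified»)
are ONE sentence. -/
theorem finrank_range_surfaceBox_eq_pairBox (a c : K) (k : ℕ) :
    finrank K (LinearMap.range (wedge K (Fin (4 * n)) k (SurfacePowers.surfaceBox K a c))) =
      finrank K (LinearMap.range (wedge K (Fin ((2 + 2) * n)) k (pairBox K (m := 2) (n := n) a c))) := by
  rw [pairBox_two_eq_surfaceBox]

/-! ## §4. One factor: the iterated model at `n = 1` IS th-7's point pair -/

/-- `m + m = (m+m)·1`. -/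
lemma one_block (m : ℕ) : m + m = (m + m) * 1 := (mul_one _).symm

/-- the re-typing `Fin (m+m) ≃o Fin ((m+m)·1)` is the block embedding of the unique block. -/
lemma castEmb_one_block_eq : (Fin.castOrderIso (one_block m)).toOrderEmbedding = blockEmb m 1 0 := by
  apply DFunLike.ext
  intro j
  exact Fin.ext (by simp only [castEmb_val, blockEmb_val, Fin.val_zero]; omega)

/-- **ONE FACTOR = th-7's POINT PAIR**: re-typed along `Fin (m+m) ≃o Fin ((m+m)·1)`, `WedgePair.pointPair K m a c` IS `pairBox K (m) (1) a c`. -/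
theorem emb_pp_eq_pairBox_one (a c : K) :
    emb K ((Fin.castOrderIso (one_block m)).toOrderEmbedding) (pp K m a c) = pairBox K (m := m) (n := 1) a c := by
  show _ = 1 * dite _ _ _
  rw [dif_pos (show 0 < 1 by norm_num), one_mul, castEmb_one_block_eq]
  rfl

/-- th-7's `WedgePair.wedgeMap` is the generic `wedge`. -/
lemma wedgeMap_pair_eq (k : ℕ) (v : WedgePair.HT K m) : WedgePair.wedgeMap K m k v = wedge K (WedgePair.I m) k v := rfl

/-- **THEOREM T, every degree, read off the uniform theorem**: `rank(θ ↦ θ ∧ (a·E_X + c·E_Y) ∣ ⋀^k K^{2m}) = [t^k] pairPoly m` for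
EVERY `k` (`m ≥ 1`, `a, c ≠ 0`; tree: `WedgePair.finrank_range_wedgeMap_pointPair` is the case `k ≤ m`, `= 2C(m,k) − [k=0] − [k=m]`). -/
theorem finrank_range_wedgeMap_pointPair_eq_coeff (hm : 1 ≤ m) {a c : K} (ha : a ≠ 0) (hc : c ≠ 0) (k : ℕ) :
    finrank K (LinearMap.range (WedgePair.wedgeMap K m k (WedgePair.pointPair K m a c))) = (pairPoly m).coeff k := by
  rw [wedgeMap_pair_eq, show WedgePair.pointPair K m a c = pp K m a c from rfl,
    ← finrank_range_wedge_emb K ((Fin.castOrderIso (one_block m)).toOrderEmbedding) (map_univ_castEmb _), emb_pp_eq_pairBox_one,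
    finrank_range_pairBox K hm le_rfl ha hc, pow_one]

/-! ## §5. Surfaces, per-`q`: the Dolbeault block projections of the two files are the same maps -/

/-- the `X`-letters of the two surface layouts agree (`x mod 4 ∈ {0,1}`). -/
lemma XX_two_eq : XX 2 n = SurfacePowers.XX n := by
  ext x
  rw [mem_XX, SurfacePowers.mem_XX]

/-- the Dolbeault index functions agree. -/
lemma qdeg_two_eq : qdeg 2 n = SurfacePowers.qdeg n := by
  funext T
  rw [qdeg, SurfacePowers.qdeg, XX_two_eq]

/-- **the per-`q` BLOCK PROJECTIONS of `WedgePointPairPowersPerQSupport` (`m = 2`) and `WedgeSurfacePowersPerQSupport` are the same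
linear map.** -/
theorem blockProj_two_eq (q : ℕ) : blockProj K 2 n q = SurfacePowers.blockProj K n q := by
  unfold blockProj SurfacePowers.blockProj
  rw [qdeg_two_eq]

/-- hence the per-`q` rank SPACES are the same submodule: p10 gen 3's surface per-`q` rank theorem
(`SurfacePowers.finrank_range_blockProj_wedge_surfaceBox`, `= spCount n k q`) and the uniform per-`q` rank theorem at `m = 2`
(`finrank_range_blockProj_wedge_pairBox`, `= genCount 2 n k q`) measure ONE space. -/
theorem range_blockProj_wedge_surfaceBox_eq (a c : K) (k q : ℕ) :
    LinearMap.range (SurfacePowers.blockProj K n q ∘ₗ wedge K (Fin (4 * n)) k (SurfacePowers.surfaceBox K (n := n) a c)) =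
      LinearMap.range (blockProj K 2 n q ∘ₗ wedge K (Fin ((2 + 2) * n)) k (pairBox K (m := 2) (n := n) a c)) := by
  rw [blockProj_two_eq, pairBox_two_eq_surfaceBox]

/-- numerical cross-check read off the two kernel theorems about that one space (over `ℚ`, `a = c = 1`):
`spCount n k q = genCount 2 n k q` for every `n, k, q` (independently: `FormulaN.Uniform.coeff_genGen_two` / `coeff_genGen`,
the generating-function edge `G_{2,n} = S_n`). -/
theorem spCount_eq_genCount_two (n k q : ℕ) : FormulaN.Uniform.spCount n k q = FormulaN.Uniform.genCount 2 n k q := by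
  rw [← SurfacePowers.finrank_range_blockProj_wedge_surfaceBox ℚ (n := n) one_ne_zero one_ne_zero k q,
    range_blockProj_wedge_surfaceBox_eq,
    finrank_range_blockProj_wedge_pairBox ℚ (m := 2) (n := n) (by norm_num) one_ne_zero one_ne_zero k q]

/-! ## §6. Two factors, per-`q`: th-7's block projections (`WedgeBoxPerQ`) are the transported ones -/

/-- the `X`-letters `X ⊔ X′` of th-7's layout are the transported `X`-letters of the iterated model. -/
lemma XX_map_castEmb_eq_P (m : ℕ) :
    (XX m 2).map (Fin.castOrderIso (two_blocks m)).toOrderEmbedding.toEmbedding = WedgeBox.P m 0 0 := by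
  ext x
  rw [WedgeBox.P, Finset.mem_union, WedgeBox.mem_A, WedgeBox.mem_C, Finset.mem_map]
  simp only [Fin.val_zero, RelEmbedding.coe_toEmbedding]
  constructor
  · rintro ⟨y, hy, rfl⟩
    rw [mem_XX] at hy
    rw [castEmb_val]
    have := y.2
    rcases Nat.lt_or_ge (y : ℕ) (m + m) with h | h
    · rw [Nat.mod_eq_of_lt h] at hy; left; omega
    · have e : (y : ℕ) % (m + m) = y - (m + m) := by
        rw [Nat.mod_eq_sub_mod h, Nat.mod_eq_of_lt (by omega)]
      rw [e] at hy; right; omega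
  · intro hx
    refine ⟨⟨x, by have := x.2; omega⟩, ?_, Fin.ext rfl⟩
    rw [mem_XX]
    simp only
    rcases hx with ⟨-, h2⟩ | ⟨h1, h2⟩
    · rw [Nat.mod_eq_of_lt (by omega)]; omega
    · rw [Nat.mod_eq_sub_mod (by omega), Nat.mod_eq_of_lt (by omega)]; omega

/-- the Dolbeault index is preserved by the re-typing. -/
lemma qdeg_map_castEmb (T : Finset (Fin ((m + m) * 2))) :
    WedgeBox.qdeg m (T.map ((Fin.castOrderIso (two_blocks m)).toOrderEmbedding).toEmbedding) = qdeg m 2 T := by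
  rw [WedgeBox.qdeg, qdeg, ← XX_map_castEmb_eq_P, ← Finset.map_sdiff, Finset.card_map]

/-- **th-7's per-`q` BLOCK PROJECTIONS are the transported ones**: `emb ∘ blockProj_q = blockProj_q ∘ emb`. -/
theorem emb_comp_blockProj_two (q : ℕ) :
    (emb K ((Fin.castOrderIso (two_blocks m)).toOrderEmbedding)).toLinearMap ∘ₗ blockProj K m 2 q =
      WedgeBox.blockProj K m q ∘ₗ (emb K ((Fin.castOrderIso (two_blocks m)).toOrderEmbedding)).toLinearMap := by
  apply (B K (Fin ((m + m) * 2))).ext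
  intro T
  rw [LinearMap.comp_apply, LinearMap.comp_apply, AlgHom.toLinearMap_apply, AlgHom.toLinearMap_apply, blockProj_B, emb_B,
    ← B_box_eq, WedgeBox.blockProj, Basis.constr_basis, qdeg_map_castEmb]
  split_ifs
  · rw [emb_B, B_box_eq]
  · rw [map_zero]

/-- the wedge range of a transported class is the transported wedge range (tree: `map_emb_range_wedge`). -/
lemma range_wedge_emb {I J : Type*} [LinearOrder I] [Fintype I] [LinearOrder J] [Fintype J] (φ : J ↪o I)
    (hφ : Finset.univ.map φ.toEmbedding = Finset.univ) (f : HT K J) (k : ℕ) :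
    LinearMap.range (wedge K I k (emb K φ f)) = (LinearMap.range (wedge K J k f)).map (emb K φ).toLinearMap := by
  rw [map_emb_range_wedge, hφ, V_univ]

/-- **th-7's per-`q` RANKS are the iterated model's**, every degree `k` and block `q`. -/
theorem finrank_range_blockProj_wedgeMap_fac_mul_eq (a c : K) (k q : ℕ) :
    finrank K (LinearMap.range (WedgeBox.blockProj K m q ∘ₗ
        WedgeBox.wedgeMap K m k (WedgeBox.fac1 K m ![a, c] * WedgeBox.fac2 K m ![a, c]))) =
      finrank K (LinearMap.range (blockProj K m 2 q ∘ₗ wedge K (Fin ((m + m) * 2)) k (pairBox K (m := m) (n := 2) a c))) := by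
  rw [wedgeMap_box_eq, ← emb_pairBox_two, LinearMap.range_comp, range_wedge_emb K _ (map_univ_castEmb _), ← Submodule.map_comp,
    ← emb_comp_blockProj_two, Submodule.map_comp, ← LinearMap.range_comp]
  exact (Submodule.equivMapOfInjective _ (emb_injective K _) _).finrank_eq.symm

/-- … hence **th-7's two-factor per-`q` law in EVERY degree, closed form**: `rank_q(θ ↦ θ ∧ (fac1 ∧ fac2) ∣ ⋀^k) = genCount m 2 k q
= [t^k u^q] G_{m,2}` (`m ≥ 1`, `a, c ≠ 0`), INCLUDING degree `0` where the `k ≥ 1` law `blockCount` of `WedgeBoxPerQCount` fails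
(`WedgeBoxPerQOverlap.perq_law_fails_in_degree_zero`; `G_{m,2} = Q_m² − u^m`, `FormulaN.Uniform.genGen_two_factors`). -/
theorem finrank_range_blockProj_wedgeMap_fac_mul_eq_genCount (hm : 1 ≤ m) {a c : K} (ha : a ≠ 0) (hc : c ≠ 0) (k q : ℕ) :
    finrank K (LinearMap.range (WedgeBox.blockProj K m q ∘ₗ
        WedgeBox.wedgeMap K m k (WedgeBox.fac1 K m ![a, c] * WedgeBox.fac2 K m ![a, c]))) =
      FormulaN.Uniform.genCount m 2 k q := by
  rw [finrank_range_blockProj_wedgeMap_fac_mul_eq, finrank_range_blockProj_wedge_pairBox K hm ha hc]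

end Summit.Ventures.HSemireg.Wedge.PairPowers
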